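import Summits.HubbardSuperconductivity.HubbardSuperconductivity.Theorems.BalabanIRBirGroundStateAverageLROSoftminPenalisedGroundStates

/-!
# Route BalabanIR — crux `BirGroundStateAverageLRO` (item `stmt-HubbardSuperconductivity-2079`), line `Sketch` (softmin-pair-penalty): every-ground-state floor ⇒ penalised thermal floor

Second of three files on the equivalence "free socket of line `Sketch` ≡ every-ground-state
order". Abstract finite-dimensional statement (`exists_penalisedThermalFloor_of_groundStateFloor`,
registered lead-held stub): `H` Hermitian, `A ⪰ 0` with `Re⟨v, Av⟩ ≤ M‖v‖²`, `K` invariant under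
both, non-trivial sector ground eigenspaces of `H` and of every penalised `H + gA`, and the
every-ground-state floor `m‖ψ‖² ≤ Re⟨ψ, Aψ⟩` on `E₀(H)` with `m > 0`; then for every budget `B`
there are `β, g > 0` with `βg ≥ B` and `(m/8)·Re tr(P_K e^{-β(H+gA)}) ≤ Re tr(P_K e^{-β(H+gA)} A)`.
Steps: gap `γ` of `H` above `e_K` (`exists_gap_above`), `g = γm/(2M(m+2M))`, every ground state
of `H + gA` in `K` has `Re⟨φ, Aφ⟩ ≥ m/4` (`re_quadForm_ge_of_penalisedGroundState`), hence the
ground-eigenspace average of `A` for `H + gA` is `≥ m/4` (`mul_re_trace_projMatrix_le_of_forall_mem`),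
and the sector Gibbs average tends to it as `β → ∞` (`tendsto_sectorGibbsAverage_atTop`), so the
floor `m/8` holds for all large `β` (`eventually_thermalFloor_of_groundSpaceFloor`; the sector
trace of a Gibbs weight is a positive real, `sector_trace_gibbsWeight_real_pos`).

Sources: H. Tasaki (2020) App. A, §2.2; Bratteli–Robinson II §5.3.1 (ground states as `β → ∞`
limits of Gibbs states); T. Kato (1966) §II.5. Folklore; no definition is introduced.
-/

noncomputable section

namespace Summit.HubbardSuperconductivity.HubbardSuperconductivity.Theorems.BirGroundStateAverageLRO.Softmin

open Matrix Finset Filter Topology Literature.MathematicalPhysics.QuantumLattice Literature.Probability.LatticeModels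
open Summit.HubbardSuperconductivity.HubbardSuperconductivity.Theses.BalabanIR
open Summit.HubbardSuperconductivity.HubbardSuperconductivity.Theorems
open scoped ComplexOrder

section Abstract

variable {n : Type*} [Fintype n] [DecidableEq n]

/-- **The sector trace of a Gibbs weight is real and positive.** For a Hermitian `X` leaving
`K ≠ ⊥` invariant, `tr(P_K e^{-βX})` is a positive real (`P_K` commutes with `e^{-βX}`, so
`P_K e^{-βX}` is Hermitian; positivity by Peierls–Jensen at any unit vector of `K`). [folklore] -/
theorem sector_trace_gibbsWeight_real_pos {X : Matrix n n ℂ} (hX : X.IsHermitian)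
    (K : Submodule ℂ (n → ℂ)) (hK : K ≠ ⊥) (hKX : ∀ v ∈ K, X *ᵥ v ∈ K) (β : ℝ) :
    (projMatrix (K.map ((WithLp.linearEquiv 2 ℂ (n → ℂ)).symm :
        (n → ℂ) →ₗ[ℂ] EuclideanSpace ℂ n)) * gibbsWeight β X).trace =
      (((projMatrix (K.map ((WithLp.linearEquiv 2 ℂ (n → ℂ)).symm :
        (n → ℂ) →ₗ[ℂ] EuclideanSpace ℂ n)) * gibbsWeight β X).trace.re : ℝ) : ℂ) ∧
    0 < (projMatrix (K.map ((WithLp.linearEquiv 2 ℂ (n → ℂ)).symm :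
        (n → ℂ) →ₗ[ℂ] EuclideanSpace ℂ n)) * gibbsWeight β X).trace.re := by
  set P := projMatrix (K.map ((WithLp.linearEquiv 2 ℂ (n → ℂ)).symm :
    (n → ℂ) →ₗ[ℂ] EuclideanSpace ℂ n)) with hP
  have hPh : P.IsHermitian := projMatrix_isHermitian _
  have hPP : P * P = P := projMatrix_mul_self _
  have hPX : Commute P X := projMatrix_map_commute_of_invariant hX K hKX
  have hW : (gibbsWeight β X).IsHermitian := (posDef_gibbsWeight β hX).isHermitian
  have hPW : Commute P (gibbsWeight β X) := by
    have : Commute P (-(β : ℂ) • X) := hPX.smul_right _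
    exact this.exp_right
  have hPWh : (P * gibbsWeight β X).IsHermitian := by
    unfold Matrix.IsHermitian
    rw [conjTranspose_mul, hW.eq, hPh.eq]
    exact hPW.eq.symm
  constructor
  · have h := Matrix.trace_conjTranspose (P * gibbsWeight β X)
    rw [hPWh.eq] at h
    exact (Complex.conj_eq_iff_re.1 h.symm).symm
  · obtain ⟨v, hvK, hv0⟩ := (Submodule.ne_bot_iff K).1 hK
    obtain ⟨c, -, hc1, -⟩ := exists_real_smul_unit_of_ne_zero hv0
    have hmem : (c : ℂ) • v ∈ K := K.smul_mem _ hvK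
    exact sectorZ_pos_of_mem hPP hPh hPX hX β _ (projMatrix_map_mulVec_of_mem K hmem) hc1

/-- **A ground-eigenspace floor persists at large `β`.** For a Hermitian `X` leaving `K`
invariant with non-trivial sector ground eigenspace `E`, if `c·Re tr P_E ≤ Re tr(P_E A)` and
`c' < c`, then `c'·Re tr(P_K e^{-βX}) ≤ Re tr(P_K e^{-βX} A)` for all large `β` (the sector Gibbs
average tends to the ground-eigenspace average, `tendsto_sectorGibbsAverage_atTop`).
Tasaki (2020) App. A. [folklore] -/
theorem eventually_thermalFloor_of_groundSpaceFloor {X : Matrix n n ℂ} (hX : X.IsHermitian)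
    (K : Submodule ℂ (n → ℂ)) (hKX : ∀ v ∈ K, X *ᵥ v ∈ K)
    (hE : K ⊓ Module.End.eigenspace (Matrix.toLin' X) ((X.minEnergyOn K : ℝ) : ℂ) ≠ ⊥)
    (A : Matrix n n ℂ) {c c' : ℝ} (hcc : c' < c)
    (hfl : c * (projMatrix ((K ⊓ Module.End.eigenspace (Matrix.toLin' X)
            ((X.minEnergyOn K : ℝ) : ℂ)).map ((WithLp.linearEquiv 2 ℂ (n → ℂ)).symm :
              (n → ℂ) →ₗ[ℂ] EuclideanSpace ℂ n))).trace.re ≤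
      (projMatrix ((K ⊓ Module.End.eigenspace (Matrix.toLin' X)
            ((X.minEnergyOn K : ℝ) : ℂ)).map ((WithLp.linearEquiv 2 ℂ (n → ℂ)).symm :
              (n → ℂ) →ₗ[ℂ] EuclideanSpace ℂ n)) * A).trace.re) :
    ∀ᶠ β : ℝ in atTop,
      c' * (projMatrix (K.map ((WithLp.linearEquiv 2 ℂ (n → ℂ)).symm :
            (n → ℂ) →ₗ[ℂ] EuclideanSpace ℂ n)) * gibbsWeight β X).trace.re ≤
        (projMatrix (K.map ((WithLp.linearEquiv 2 ℂ (n → ℂ)).symm :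
            (n → ℂ) →ₗ[ℂ] EuclideanSpace ℂ n)) * gibbsWeight β X * A).trace.re := by
  have hlim := tendsto_sectorGibbsAverage_atTop hX K hKX hE A
  set E : Submodule ℂ (n → ℂ) := K ⊓ Module.End.eigenspace (Matrix.toLin' X)
    ((X.minEnergyOn K : ℝ) : ℂ) with hEdef
  set P₀ := projMatrix (E.map ((WithLp.linearEquiv 2 ℂ (n → ℂ)).symm :
    (n → ℂ) →ₗ[ℂ] EuclideanSpace ℂ n)) with hP₀
  set P := projMatrix (K.map ((WithLp.linearEquiv 2 ℂ (n → ℂ)).symm :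
    (n → ℂ) →ₗ[ℂ] EuclideanSpace ℂ n)) with hP
  have hre := (Complex.continuous_re.tendsto _).comp hlim
  have htr : P₀.trace = (Module.finrank ℂ E : ℂ) := trace_projMatrix_map_eq_finrank E
  have hm : (0 : ℝ) < (Module.finrank ℂ E : ℝ) :=
    Nat.cast_pos.mpr (Submodule.one_le_finrank_iff.mpr hE)
  -- the limit exceeds `c'`
  have hlt : c' < ((P₀ * A).trace / P₀.trace).re := by
    rw [htr, Complex.div_natCast_re, lt_div_iff₀ hm]
    rw [htr, Complex.natCast_re] at hfl
    nlinarith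
  have hK : K ≠ ⊥ := by
    intro hK
    apply hE
    rw [hEdef, hK, bot_inf_eq]
  filter_upwards [hre.eventually (Ioi_mem_nhds hlt)] with β hβ
  simp only [Function.comp_apply] at hβ
  obtain ⟨hreal, hpos⟩ := sector_trace_gibbsWeight_real_pos hX K hK hKX β
  rw [← hP] at hreal hpos
  rw [hreal, Complex.div_ofReal_re, lt_div_iff₀ hpos] at hβ
  exact hβ.le

omit [Fintype n] [DecidableEq n] in
/-- A real multiple of a Hermitian matrix added to a Hermitian matrix is Hermitian. [folklore] -/
theorem isHermitian_add_real_smul {H A : Matrix n n ℂ} (hH : H.IsHermitian) (hA : A.IsHermitian)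
    (g : ℝ) : (H + ((g : ℝ) : ℂ) • A).IsHermitian := by
  refine hH.add ?_
  unfold Matrix.IsHermitian
  rw [conjTranspose_smul, hA.eq, Complex.star_def, Complex.conj_ofReal]

/-- **Every-ground-state floor ⇒ penalised thermal floor (abstract).** `H` Hermitian, `A ⪰ 0`
with `Re⟨v, Av⟩ ≤ M‖v‖²`, `K` invariant under both, the sector ground eigenspace `E₀` of `H`
non-trivial and likewise for every penalised `H + gA` (`g > 0`), and the every-ground-state floor
`m‖ψ‖² ≤ Re⟨ψ, Aψ⟩` on `E₀` with `m > 0`. Then for every budget `B` there are `β, g > 0` with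
`βg ≥ B` and `(m/8)·Re tr(P_K e^{-β(H+gA)}) ≤ Re tr(P_K e^{-β(H+gA)} A)`.
(Gap `γ` of `H` above `e_K`; `g = γm/(2M(m+2M))`; every ground state of `H + gA` in `K` has
`Re⟨φ, Aφ⟩ ≥ m/4`; pass to large `β`.) Kato (1966) §II.5; Tasaki (2020) App. A. [folklore] -/
theorem exists_penalisedThermalFloor_of_groundStateFloor {H A : Matrix n n ℂ} (hH : H.IsHermitian)
    (hA : A.PosSemidef) (K : Submodule ℂ (n → ℂ)) (hKH : ∀ v ∈ K, H *ᵥ v ∈ K)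
    (hKA : ∀ v ∈ K, A *ᵥ v ∈ K)
    (hE₀ : K ⊓ Module.End.eigenspace (Matrix.toLin' H) ((H.minEnergyOn K : ℝ) : ℂ) ≠ ⊥)
    (hEg : ∀ g : ℝ, 0 < g → K ⊓ Module.End.eigenspace (Matrix.toLin' (H + ((g : ℝ) : ℂ) • A))
      (((H + ((g : ℝ) : ℂ) • A).minEnergyOn K : ℝ) : ℂ) ≠ ⊥)
    {M m : ℝ} (hM : ∀ v : n → ℂ, (star v ⬝ᵥ (A *ᵥ v)).re ≤ M * (star v ⬝ᵥ v).re) (hm0 : 0 < m)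
    (hm : ∀ ψ ∈ K ⊓ Module.End.eigenspace (Matrix.toLin' H) ((H.minEnergyOn K : ℝ) : ℂ),
      m * (star ψ ⬝ᵥ ψ).re ≤ (star ψ ⬝ᵥ (A *ᵥ ψ)).re)
    (B : ℝ) :
    ∃ β g : ℝ, 0 < β ∧ 0 < g ∧ B ≤ β * g ∧
      m / 8 * (projMatrix (K.map ((WithLp.linearEquiv 2 ℂ (n → ℂ)).symm :
            (n → ℂ) →ₗ[ℂ] EuclideanSpace ℂ n)) * gibbsWeight β (H + ((g : ℝ) : ℂ) • A)).trace.re ≤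
        (projMatrix (K.map ((WithLp.linearEquiv 2 ℂ (n → ℂ)).symm :
            (n → ℂ) →ₗ[ℂ] EuclideanSpace ℂ n)) * gibbsWeight β (H + ((g : ℝ) : ℂ) • A) * A).trace.re := by
  set e : ℝ := H.minEnergyOn K with he
  set E₀ : Submodule ℂ (n → ℂ) := K ⊓ Module.End.eigenspace (Matrix.toLin' H) ((e : ℝ) : ℂ)
    with hE₀def
  -- a unit ground state of `H` in `K`; hence `m ≤ M`, `M > 0`
  obtain ⟨v, hvE, hv0⟩ := (Submodule.ne_bot_iff E₀).1 hE₀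
  obtain ⟨c, -, hc1, -⟩ := exists_real_smul_unit_of_ne_zero hv0
  set ψ₁ : n → ℂ := (c : ℂ) • v with hψ₁
  have hψ₁E : ψ₁ ∈ E₀ := E₀.smul_mem _ hvE
  have hψ₁K : ψ₁ ∈ K := (Submodule.mem_inf.1 hψ₁E).1
  have hHψ₁ : H *ᵥ ψ₁ = ((e : ℝ) : ℂ) • ψ₁ := by
    have := (Submodule.mem_inf.1 hψ₁E).2
    rwa [Module.End.mem_eigenspace_iff, Matrix.toLin'_apply] at this
  have hmM : m ≤ M := by
    have h1 := hm ψ₁ hψ₁E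
    have h2 := hM ψ₁
    rw [hc1, Complex.one_re, mul_one] at h1 h2
    linarith
  have hMpos : 0 < M := lt_of_lt_of_le hm0 hmM
  -- the gap and the penalty strength
  obtain ⟨γ, hγ, hgap⟩ := exists_gap_above hH.eigenvalues e
  set g : ℝ := γ * m / (2 * M * (m + 2 * M)) with hgdef
  have hden : 0 < 2 * M * (m + 2 * M) := by positivity
  have hg : 0 < g := div_pos (mul_pos hγ hm0) hden
  have hgs : 2 * g * M * (m + 2 * M) ≤ γ * m := by
    have : 2 * g * M * (m + 2 * M) = γ * m := by
      rw [hgdef]; field_simp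
    rw [this]
  -- the penalised Hamiltonian
  set X : Matrix n n ℂ := H + ((g : ℝ) : ℂ) • A with hXdef
  have hX : X.IsHermitian := isHermitian_add_real_smul hH hA.isHermitian g
  have hKX : ∀ w ∈ K, X *ᵥ w ∈ K := fun w hw => by
    rw [hXdef, add_mulVec, smul_mulVec]
    exact K.add_mem (hKH w hw) (K.smul_mem _ (hKA w hw))
  have hEX := hEg g hg
  set eX : ℝ := X.minEnergyOn K with heX
  set EX : Submodule ℂ (n → ℂ) := K ⊓ Module.End.eigenspace (Matrix.toLin' X) ((eX : ℝ) : ℂ)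
    with hEXdef
  -- Rayleigh quotient of `X`
  have hray : ∀ w : n → ℂ, (star w ⬝ᵥ (X *ᵥ w)).re =
      (star w ⬝ᵥ (H *ᵥ w)).re + g * (star w ⬝ᵥ (A *ᵥ w)).re := by
    intro w
    rw [hXdef, add_mulVec, smul_mulVec, dotProduct_add, dotProduct_smul, smul_eq_mul,
      Complex.add_re, Complex.re_ofReal_mul]
  -- variational ceiling: `eX ≤ e + g M`
  have hceil : eX ≤ e + g * M := by
    have h1 := minEnergyOn_le_rayleigh_of_mem hX K hψ₁K hc1
    rw [hray ψ₁] at h1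
    have h2 : (star ψ₁ ⬝ᵥ (H *ᵥ ψ₁)).re = e := by
      rw [hHψ₁, dotProduct_smul, smul_eq_mul, hc1, mul_one, Complex.ofReal_re]
    have h3 := hM ψ₁
    rw [hc1, Complex.one_re, mul_one] at h3
    rw [h2] at h1
    nlinarith
  -- every ground state of `X` in `K` has `Re⟨φ, Aφ⟩ ≥ m/4`
  have hunit : ∀ φ ∈ EX, star φ ⬝ᵥ φ = 1 → m / 4 ≤ (star φ ⬝ᵥ (A *ᵥ φ)).re := by
    intro φ hφ hφ1
    obtain ⟨hφK, hφeig⟩ := Submodule.mem_inf.1 hφ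
    rw [Module.End.mem_eigenspace_iff, Matrix.toLin'_apply] at hφeig
    have hE1 : (star φ ⬝ᵥ (X *ᵥ φ)).re = eX := by
      rw [hφeig, dotProduct_smul, smul_eq_mul, hφ1, mul_one, Complex.ofReal_re]
    have hφE : (star φ ⬝ᵥ (H *ᵥ φ)).re + g * (star φ ⬝ᵥ (A *ᵥ φ)).re ≤ e + g * M := by
      rw [← hray φ, hE1]; exact hceil
    exact re_quadForm_ge_of_penalisedGroundState hH hA K hKH hM hm0.le hm hγ hgap hg hgs hφK
      hφ1 hφE
  have hhom : ∀ φ ∈ EX, m / 4 * (star φ ⬝ᵥ φ).re ≤ (star φ ⬝ᵥ (A *ᵥ φ)).re :=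
    fun φ hφ => mul_re_le_re_quadForm_of_unit_bound EX hunit φ hφ
  have hfl := mul_re_trace_projMatrix_le_of_forall_mem EX A (m / 4) hhom
  -- pass to large `β`
  have hev := eventually_thermalFloor_of_groundSpaceFloor hX K hKX hEX A
    (c := m / 4) (c' := m / 8) (by linarith) hfl
  obtain ⟨β, hβfl, hβge⟩ := (hev.and (eventually_ge_atTop (max 1 (B / g)))).exists
  refine ⟨β, g, lt_of_lt_of_le one_pos ((le_max_left _ _).trans hβge), hg, ?_, hβfl⟩
  have : B / g ≤ β := (le_max_right _ _).trans hβge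
  rwa [div_le_iff₀ hg] at this

end Abstract

end Summit.HubbardSuperconductivity.HubbardSuperconductivity.Theorems.BirGroundStateAverageLRO.Softmin
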